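import Mathlib
import Summits.ValiantsHypothesis.ValiantsHypothesis.Theorems.SymPencilEquivariantSdcNotQPProof
import Summits.ValiantsHypothesis.ValiantsHypothesis.Theorems.SymPencilSymmetrizePermPairsStubInduce
import HarnessLib

/-!
# STRATEGY-CENSUS signatures — crux `SymPencil.SymmetrizePermPairs` (stmt-ValiantsHypothesis-17793),
# stub `stub_stabIndex` (crux-strategist cstrat-17793, 2026-08-28)

Typed forms of the statements examined in `STRATEGY-CENSUS.md` (Transfer / Strengthen /
Decomposition / Negation).  DEFINITIONS ONLY (+ two elementary implications); nothing here is a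
stub, an item or progress on `VP ≠ VNP`.  `Γ_n` is spelled out as the closure used by the route items.
-/

noncomputable section

set_option linter.dupNamespace false

namespace Summit.ValiantsHypothesis.ValiantsHypothesis.Cruxes.SymmetrizePermPairs.Census

open Literature.Computability.AlgebraicComplexity MvPolynomial Matrix
open Summit.ValiantsHypothesis.ValiantsHypothesis.Theses

/-- The registered stub `stub_stabIndex` as a proposition (verbatim, closure spelled out). -/
def StabIndex : Prop :=
  ∃ d : ℕ, ∀ (n m : ℕ) (A : Matrix (Fin m) (Fin m) (MvPolynomial (Fin n × Fin n) ℂ)),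
    A.IsSymm → IsAffineDetRepr (perPoly (Fin n) ℂ) A →
    (∀ (m' : ℕ) (A' : Matrix (Fin m') (Fin m') (MvPolynomial (Fin n × Fin n) ℂ)),
      A'.IsSymm → IsAffineDetRepr (perPoly (Fin n) ℂ) A' → m ≤ m') →
    ∃ Γ' : Subgroup (GL (Fin n × Fin n) ℂ), Γ' ≤ Subgroup.closure {γ : GL (Fin n × Fin n) ℂ | ∃ π ρ : Equiv.Perm (Fin n), (γ : Matrix (Fin n × Fin n) (Fin n × Fin n) ℂ) = Equiv.Perm.permMatrix ℂ (Equiv.prodCongr π ρ)} ∧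
      Γ'.relIndex (Subgroup.closure {γ : GL (Fin n × Fin n) ℂ | ∃ π ρ : Equiv.Perm (Fin n), (γ : Matrix (Fin n × Fin n) (Fin n × Fin n) ℂ) = Equiv.Perm.permMatrix ℂ (Equiv.prodCongr π ρ)}) ≤ 2 ^ ((Nat.log 2 m + d) ^ d) ∧
      IsEquivariantDetRepr Γ' (perPoly (Fin n) ℂ) A

/-! ## Strengthen -/

/-- **S⁺₁ = H (`FactorialSqLe`)**: the symmetry-free a.e. weakly-exponential lower bound
`(n!)² ≤ 2^{(log₂ m + e)^e}` for every symmetric affine pencil of `per_n` of size `m`.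
`H → StabIndex` with `Γ' = ⊥` (Sandwich: `stabIndex_of_factorialSq_le`). -/
def FactorialSqLe : Prop :=
  ∃ e : ℕ, ∀ (n m : ℕ) (A : Matrix (Fin m) (Fin m) (MvPolynomial (Fin n × Fin n) ℂ)),
    A.IsSymm → IsAffineDetRepr (perPoly (Fin n) ℂ) A →
    (Nat.factorial n) ^ 2 ≤ 2 ^ ((Nat.log 2 m + e) ^ e)

/-- **S⁺₂ (`AlternatingCore`)**: every MINIMAL symmetric affine pencil of `per_n` is equivariant
(exact `GL × GL` lifts) for the even row/column permutation pairs `A_n × A_n` (index `≤ 4` in `Γ_n`):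
the rigid, `d`-free form of `stub_stabIndex`. -/
def AlternatingCore : Prop :=
  ∀ (n m : ℕ) (A : Matrix (Fin m) (Fin m) (MvPolynomial (Fin n × Fin n) ℂ)),
    A.IsSymm → IsAffineDetRepr (perPoly (Fin n) ℂ) A →
    (∀ (m' : ℕ) (A' : Matrix (Fin m') (Fin m') (MvPolynomial (Fin n × Fin n) ℂ)),
      A'.IsSymm → IsAffineDetRepr (perPoly (Fin n) ℂ) A' → m ≤ m') →
    IsEquivariantDetRepr
      (Subgroup.closure {γ : GL (Fin n × Fin n) ℂ | ∃ π ρ : Equiv.Perm (Fin n),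
        Equiv.Perm.sign π = 1 ∧ Equiv.Perm.sign ρ = 1 ∧
        (γ : Matrix (Fin n × Fin n) (Fin n × Fin n) ℂ) = Equiv.Perm.permMatrix ℂ (Equiv.prodCongr π ρ)})
      (perPoly (Fin n) ℂ) A

/-- **S⁺₃ (`FullCore`, index 1)**: every minimal symmetric pencil of `per_n` is `Γ_n`-equivariant.
`FullCore → StabIndex` with `d = 0` is immediate (below). -/
def FullCore : Prop :=
  ∀ (n m : ℕ) (A : Matrix (Fin m) (Fin m) (MvPolynomial (Fin n × Fin n) ℂ)),
    A.IsSymm → IsAffineDetRepr (perPoly (Fin n) ℂ) A →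
    (∀ (m' : ℕ) (A' : Matrix (Fin m') (Fin m') (MvPolynomial (Fin n × Fin n) ℂ)),
      A'.IsSymm → IsAffineDetRepr (perPoly (Fin n) ℂ) A' → m ≤ m') →
    IsEquivariantDetRepr (Subgroup.closure {γ : GL (Fin n × Fin n) ℂ | ∃ π ρ : Equiv.Perm (Fin n), (γ : Matrix (Fin n × Fin n) (Fin n × Fin n) ℂ) = Equiv.Perm.permMatrix ℂ (Equiv.prodCongr π ρ)}) (perPoly (Fin n) ℂ) A

/-- `FullCore → StabIndex` (take `Γ' = Γ_n`, relative index `1`). [folklore] -/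
theorem stabIndex_of_fullCore (h : FullCore) : StabIndex := by
  refine ⟨0, fun n m A hAs hA hmin => ⟨_, le_rfl, ?_, h n m A hAs hA hmin⟩⟩
  rw [Subgroup.relIndex_self]
  exact Nat.one_le_two_pow

/-! ## Decomposition (best typed split; abstract "class function" form) -/

/-- **Sub₁ (`FewStableClasses`)**: at the minimal size `m = sdc(per_n)` there is a `Γ_n`-compatible
labelling of the symmetric pencils of `per_n` by `≤ 2^{(log₂ m + d)^d}` classes (intended model:
irreducible components of the variety of minimal symmetric pencils modulo the connected gauge
group; abstractly: any labelling on which `Γ_n` acts by permutations). -/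
def FewStableClasses : Prop :=
  ∃ d : ℕ, ∀ (n m : ℕ),
    (∃ A : Matrix (Fin m) (Fin m) (MvPolynomial (Fin n × Fin n) ℂ),
      A.IsSymm ∧ IsAffineDetRepr (perPoly (Fin n) ℂ) A) →
    (∀ (m' : ℕ) (A' : Matrix (Fin m') (Fin m') (MvPolynomial (Fin n × Fin n) ℂ)),
      A'.IsSymm → IsAffineDetRepr (perPoly (Fin n) ℂ) A' → m ≤ m') →
    ∃ (k : ℕ) (c : Matrix (Fin m) (Fin m) (MvPolynomial (Fin n × Fin n) ℂ) → Fin k),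
      k ≤ 2 ^ ((Nat.log 2 m + d) ^ d) ∧
      ∀ γ ∈ Subgroup.closure {γ : GL (Fin n × Fin n) ℂ | ∃ π ρ : Equiv.Perm (Fin n), (γ : Matrix (Fin n × Fin n) (Fin n × Fin n) ℂ) = Equiv.Perm.permMatrix ℂ (Equiv.prodCongr π ρ)}, ∃ σ : Equiv.Perm (Fin k),
        ∀ A : Matrix (Fin m) (Fin m) (MvPolynomial (Fin n × Fin n) ℂ),
          A.IsSymm → IsAffineDetRepr (perPoly (Fin n) ℂ) A →
          c (Matrix.linSubstEntries γ A) = σ (c A)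

/-- **Sub₂ (`FixedClassInStableFibre`)**: a class stabilised by `Γ'' ≤ Γ_n` contains a
`Γ''`-EQUIVARIANT symmetric pencil (intended model: a finite group acting on an irreducible
component of an affine `G`-variety has a fixed gauge orbit — false in general; abstractly, with an
arbitrary labelling `c`, the case `k = 1` already says "symmetrise at EQUAL size"). -/
def FixedClassInStableFibre : Prop :=
  ∀ (n m k : ℕ) (c : Matrix (Fin m) (Fin m) (MvPolynomial (Fin n × Fin n) ℂ) → Fin k)
    (Γ'' : Subgroup (GL (Fin n × Fin n) ℂ)) (i : Fin k),
    Γ'' ≤ Subgroup.closure {γ : GL (Fin n × Fin n) ℂ | ∃ π ρ : Equiv.Perm (Fin n), (γ : Matrix (Fin n × Fin n) (Fin n × Fin n) ℂ) = Equiv.Perm.permMatrix ℂ (Equiv.prodCongr π ρ)} →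
    (∀ γ ∈ Γ'', ∀ A : Matrix (Fin m) (Fin m) (MvPolynomial (Fin n × Fin n) ℂ),
      A.IsSymm → IsAffineDetRepr (perPoly (Fin n) ℂ) A → c A = i →
      c (Matrix.linSubstEntries γ A) = i) →
    (∃ A : Matrix (Fin m) (Fin m) (MvPolynomial (Fin n × Fin n) ℂ),
      A.IsSymm ∧ IsAffineDetRepr (perPoly (Fin n) ℂ) A ∧ c A = i) →
    ∃ A : Matrix (Fin m) (Fin m) (MvPolynomial (Fin n × Fin n) ℂ),
      A.IsSymm ∧ c A = i ∧ IsEquivariantDetRepr Γ'' (perPoly (Fin n) ℂ) A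

/-- The abstract split degenerates: `FixedClassInStableFibre` at `k = 1`, `Γ'' = Γ_n` is
symmetrisation at EQUAL size — it gives `SymmetrizePermPairs` outright with `m' = m` (so Sub₂ alone
is ≥ the crux; the split is not a reduction). [folklore] -/
theorem symmetrizePermPairs_of_fixedClass (h : FixedClassInStableFibre) :
    SymPencil.SymmetrizePermPairs := by
  refine ⟨1, fun n m A hAs hA => ?_⟩
  obtain ⟨A', hA's, -, hA'⟩ := h n m 1 (fun _ => 0) _ 0 le_rfl
    (fun _ _ _ _ _ _ => rfl) ⟨A, hAs, hA, rfl⟩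
  refine ⟨m, ?_, A', hA's, hA'⟩
  have h1 : m < 2 ^ (Nat.log 2 m + 1) := Nat.lt_pow_succ_log_self one_lt_two m
  rw [pow_one]
  exact h1.le

end Summit.ValiantsHypothesis.ValiantsHypothesis.Cruxes.SymmetrizePermPairs.Census

end
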